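import Summits.Ventures.LatticeQCDFlow.TrivializingMaps.WilsonActionFluctuates
import Summits.Ventures.LatticeQCDFlow.TrivializingMaps.HaarIntegrationByParts
import Literature.MathematicalPhysics.QuantumFieldTheory.StrongCouplingActivities

/-!
HONEST FRAMING: exact (Metropolis-corrected) sampling algorithms for lattice gauge theory; figures
of merit are autocorrelation/cost numbers at stated couplings and volumes; no continuum-physics
claim.

# PlaquetteHaarMoments — under the trivial theory a single plaquette holonomy is Haar distributed
# (every volume `L ≥ 2`), so its moments are volume-independent group integrals (lean-2 GEN-6, ours)

Venture-side (OURS).  Cell `lqcd-flow` (pub-lqcd), unit `pub-lqcd-lean-2-g6`, 2026-08-22.  First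
piece of the infrastructure for a VOLUME-UNIFORM version of `FisherZeroRadiusBound` /
`WilsonActionFluctuates` (there: `Var_{D[U]}(S_W) > 0`; wanted: `= m₂(n) · #plaquettes`).

* `plaquetteHolonomy_mulSingle_left` — left-multiplying the link `(x, i)` by `h` multiplies the
  holonomy of the plaquette `(x, i, j)` (`i ≠ j`, `L ≥ 2`) by `h` on the left and leaves the other
  three links alone.
* **`integral_comp_plaquetteHolonomy_eq_haar`** — for every `L ≥ 2`, `i ≠ j`, site `x` and continuous
  `φ : SU(n) → ℝ`: `∫ D[U] φ(U_p) = ∫_{SU(n)} φ dg` (left invariance of `D[U]` at the link `(x,i)`,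
  Fubini over `Haar(SU(n)) ⊗ D[U]`, right invariance of Haar): the law of one plaquette holonomy
  under the trivial theory is Haar, in every volume and dimension.
* `integral_trace_haar_eq_zero` — `∫_{SU(n)} tr g dg = 0` for `n ≥ 2` (left invariance under the
  central element `e^{2πi/n}·1`), hence `integral_re_trace_plaquetteHolonomy_eq_zero`:
  `E_{D[U]}[Re tr U_p] = 0` and **`integral_ambWilsonAction_trivial`**: `E_{D[U]}[S_W] = n · #plaquettes`
  (Lüscher's `Ċ^{(0)} = -⟨S_W⟩₀ = -n·#plaq`, every `L ≥ 2`).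
* `haarSqReTrace_pos` — `m₂(n) := ∫_{SU(n)} (Re tr g)² dg > 0` and
  `integral_sq_re_trace_plaquetteHolonomy` — `E_{D[U]}[(Re tr U_p)²] = m₂(n)`, volume-independent.

NOT CLAIMED: pairwise decorrelation of distinct plaquettes and `Var_{D[U]}(S_W) = m₂(n)·#plaq`
(next file); the value of `m₂(n)` (`= 1` for `n = 2`, `½` for `n ≥ 3`, classical); `L = 1`.
-/

open MeasureTheory ProbabilityTheory Filter Topology Complex Set Metric
open Literature.MathematicalPhysics.QuantumFieldTheory
open Literature.MathematicalPhysics.QuantumFieldTheory.Luscher2010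
open Literature.MathematicalPhysics.QuantumFieldTheory.WilsonFlow (coeConfig continuous_coeConfig)
open scoped Matrix Matrix.Norms.Frobenius ContDiff

namespace Summit.Ventures.LatticeQCDFlow.TrivializingMaps

/-! ## §1 Lattice bookkeeping: left-multiplying the first link of a plaquette -/

section Lattice

variable {d L : ℕ} {G : Type*} [Group G]

/-- For `L ≥ 2` a unit shift moves every site: `x.shift j ≠ x`. [folklore] -/
theorem site_shift_ne_self_of_two_le [NeZero L] (hL : 2 ≤ L) (x : Site d L) (j : Fin d) :
    x.shift j ≠ x := by
  haveI : Fact (1 < L) := ⟨by omega⟩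
  intro h
  have h1 : (x.shift j) j = x j := by rw [h]
  simp [Site.shift] at h1

/-- **Left multiplication of the link `(x,i)` multiplies the holonomy of the plaquette `(x,i,j)` on
the left** (`i ≠ j`, `L ≥ 2`: the other three links of the plaquette are different links).
[folklore] -/
theorem plaquetteHolonomy_mulSingle_left [NeZero L] [DecidableEq (Edge d L)] (hL : 2 ≤ L)
    (U : GaugeConfig d L G) (x : Site d L) {i j : Fin d} (hij : i ≠ j) (h : G) :
    plaquetteHolonomy (Pi.mulSingle (x, i) h * U) x i j = h * plaquetteHolonomy U x i j := by
  have h1 : ((x.shift i, j) : Edge d L) ≠ (x, i) := fun e => hij.symm (congrArg Prod.snd e)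
  have h2 : ((x.shift j, i) : Edge d L) ≠ (x, i) := fun e =>
    site_shift_ne_self_of_two_le hL x j (congrArg Prod.fst e)
  have h3 : ((x, j) : Edge d L) ≠ (x, i) := fun e => hij.symm (congrArg Prod.snd e)
  simp only [plaquetteHolonomy, Pi.mul_apply, Pi.mulSingle_eq_same, Pi.mulSingle_eq_of_ne h1,
    Pi.mulSingle_eq_of_ne h2, Pi.mulSingle_eq_of_ne h3, one_mul, mul_assoc]

end Lattice

/-! ## §2 One plaquette holonomy is Haar distributed under the trivial theory -/

section Haar

variable {d L n : ℕ} [NeZero L]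

/-- **`∫ D[U] φ(U_p) = ∫_{SU(n)} φ dg`** for every continuous `φ`, every plaquette `p = (x,i,j)`
(`i ≠ j`) and every volume `L ≥ 2`: the law of a single plaquette holonomy under the product Haar
measure is the Haar measure. [folklore] -/
theorem integral_comp_plaquetteHolonomy_eq_haar (hL : 2 ≤ L) (x : Site d L) {i j : Fin d} (hij : i ≠ j)
    {φ : Matrix.specialUnitaryGroup (Fin n) ℂ → ℝ} (hφ : Continuous φ) :
    ∫ U, φ (plaquetteHolonomy U x i j) ∂(trivialMeasure (Matrix.specialUnitaryGroup (Fin n) ℂ) d L)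
      = ∫ g, φ g ∂(haarProbability (Matrix.specialUnitaryGroup (Fin n) ℂ)) := by
  classical
  set D := trivialMeasure (Matrix.specialUnitaryGroup (Fin n) ℂ) d L with hD
  set μ := haarProbability (Matrix.specialUnitaryGroup (Fin n) ℂ) with hμ
  haveI : D.IsMulLeftInvariant := by rw [hD]; unfold trivialMeasure; infer_instance
  haveI : IsProbabilityMeasure D := by rw [hD]; unfold trivialMeasure; infer_instance
  have hhol : Continuous fun U : GaugeConfig d L (Matrix.specialUnitaryGroup (Fin n) ℂ) =>
      plaquetteHolonomy U x i j := by
    unfold plaquetteHolonomy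
    fun_prop
  -- (1) left invariance at the link `(x, i)`: `∫ φ(h · U_p) dD = ∫ φ(U_p) dD` for every `h`
  have hinv : ∀ h : Matrix.specialUnitaryGroup (Fin n) ℂ,
      ∫ U, φ (h * plaquetteHolonomy U x i j) ∂D = ∫ U, φ (plaquetteHolonomy U x i j) ∂D := by
    intro h
    have key := integral_mul_left_eq_self (μ := D) (fun U => φ (plaquetteHolonomy U x i j))
      (Pi.mulSingle (x, i) h)
    have hfun : (fun U : GaugeConfig d L (Matrix.specialUnitaryGroup (Fin n) ℂ) =>
        φ (plaquetteHolonomy (Pi.mulSingle (x, i) h * U) x i j)) =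
        fun U => φ (h * plaquetteHolonomy U x i j) :=
      funext fun U => by rw [plaquetteHolonomy_mulSingle_left hL U x hij h]
    rw [hfun] at key
    exact key
  -- (2) integrate (1) over `h` (Fubini) and use right invariance of Haar
  have hF : Continuous fun q : Matrix.specialUnitaryGroup (Fin n) ℂ ×
      GaugeConfig d L (Matrix.specialUnitaryGroup (Fin n) ℂ) => φ (q.1 * plaquetteHolonomy q.2 x i j) :=
    hφ.comp (continuous_fst.mul (hhol.comp continuous_snd))
  have hint : Integrable (Function.uncurry fun (h : Matrix.specialUnitaryGroup (Fin n) ℂ)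
      (U : GaugeConfig d L (Matrix.specialUnitaryGroup (Fin n) ℂ)) =>
        φ (h * plaquetteHolonomy U x i j)) (μ.prod D) := by
    haveI : SecondCountableTopology (Matrix (Fin n) (Fin n) ℂ) :=
      inferInstanceAs (SecondCountableTopology (Fin n → Fin n → ℂ))
    haveI : SecondCountableTopology (Matrix.specialUnitaryGroup (Fin n) ℂ) :=
      Topology.IsEmbedding.subtypeVal.secondCountableTopology
    exact (BoundedContinuousFunction.mkOfCompact ⟨_, hF⟩).integrable _
  calc ∫ U, φ (plaquetteHolonomy U x i j) ∂D
      = ∫ h, ∫ U, φ (plaquetteHolonomy U x i j) ∂D ∂μ := by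
        rw [integral_const, smul_eq_mul, probReal_univ, one_mul]
    _ = ∫ h, ∫ U, φ (h * plaquetteHolonomy U x i j) ∂D ∂μ := by
        refine integral_congr_ae (ae_of_all _ fun h => (hinv h).symm)
    _ = ∫ U, ∫ h, φ (h * plaquetteHolonomy U x i j) ∂μ ∂D := integral_integral_swap hint
    _ = ∫ U, ∫ h, φ h ∂μ ∂D := by
        refine integral_congr_ae (ae_of_all _ fun U => ?_)
        exact integral_mul_right_eq_self (μ := μ) φ (plaquetteHolonomy U x i j)
    _ = ∫ g, φ g ∂μ := by
        rw [integral_const, smul_eq_mul, probReal_univ, one_mul]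

/-- **`∫_{SU(n)} tr g dg = 0` for `n ≥ 2`** (left invariance under the central element
`e^{2πi/n} · 1 ∈ SU(n)`, whose trace factor `e^{2πi/n} ≠ 1`). [folklore] -/
theorem integral_trace_haar_eq_zero (hn : 2 ≤ n) :
    ∫ g, ((g : Matrix (Fin n) (Fin n) ℂ)).trace ∂(haarProbability (Matrix.specialUnitaryGroup (Fin n) ℂ))
      = 0 := by
  set μ := haarProbability (Matrix.specialUnitaryGroup (Fin n) ℂ) with hμ
  set ζ : ℂ := Complex.exp (2 * Real.pi * I / n) with hζdef
  have hn0 : (n : ℂ) ≠ 0 := by exact_mod_cast (show n ≠ 0 by omega)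
  have hζn : ζ ^ n = 1 := by
    rw [hζdef, ← Complex.exp_nat_mul, mul_div_cancel₀ _ hn0, Complex.exp_two_pi_mul_I]
  have hζ1 : ζ ≠ 1 := by
    intro h
    rw [hζdef, Complex.exp_eq_one_iff] at h
    obtain ⟨k, hk⟩ := h
    have h2 : (2 * Real.pi * I : ℂ) ≠ 0 := by simp [Real.pi_ne_zero, Complex.I_ne_zero]
    have h3 : (2 * Real.pi * I : ℂ) = k * (2 * Real.pi * I) * n := by
      have := congrArg (fun z : ℂ => z * n) hk
      simpa [div_mul_cancel₀ _ hn0] using this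
    have h4 : (2 * Real.pi * I : ℂ) * 1 = (2 * Real.pi * I) * (k * n) := by
      rw [mul_one]; linear_combination h3
    have hkn : (k : ℂ) * n = 1 := (mul_left_cancel₀ h2 h4).symm
    have hkz : k * (n : ℤ) = 1 := by exact_mod_cast hkn
    have hn1 : (n : ℤ) = 1 := Int.eq_one_of_mul_eq_one_left (by positivity) hkz
    omega
  -- the central element
  have hζu : ‖ζ‖ = 1 := by
    have : ‖ζ‖ ^ n = 1 := by rw [← norm_pow, hζn, norm_one]
    exact (pow_eq_one_iff_of_nonneg (norm_nonneg _) (by omega)).mp this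
  have hmem : ζ • (1 : Matrix (Fin n) (Fin n) ℂ) ∈ Matrix.specialUnitaryGroup (Fin n) ℂ := by
    rw [Matrix.mem_specialUnitaryGroup_iff]
    refine ⟨?_, ?_⟩
    · rw [Matrix.mem_unitaryGroup_iff, Matrix.star_eq_conjTranspose, Matrix.conjTranspose_smul,
        Matrix.conjTranspose_one, Matrix.smul_mul, one_mul, smul_smul, Complex.star_def,
        Complex.mul_conj, Complex.normSq_eq_norm_sq, hζu]
      simp
    · rw [Matrix.det_smul, Matrix.det_one, mul_one, Fintype.card_fin, hζn]
  set c : Matrix.specialUnitaryGroup (Fin n) ℂ := ⟨ζ • 1, hmem⟩ with hcdef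
  have hinv := integral_mul_left_eq_self (μ := μ)
    (fun g : Matrix.specialUnitaryGroup (Fin n) ℂ => ((g : Matrix (Fin n) (Fin n) ℂ)).trace) c
  have hmul : ∀ g : Matrix.specialUnitaryGroup (Fin n) ℂ,
      (((c * g : Matrix.specialUnitaryGroup (Fin n) ℂ) : Matrix (Fin n) (Fin n) ℂ)).trace =
        ζ * ((g : Matrix (Fin n) (Fin n) ℂ)).trace := fun g => by
    show ((ζ • (1 : Matrix (Fin n) (Fin n) ℂ)) * (g : Matrix (Fin n) (Fin n) ℂ)).trace = _
    rw [Matrix.smul_mul, one_mul, Matrix.trace_smul, smul_eq_mul]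
  simp only [hmul] at hinv
  rw [integral_const_mul] at hinv
  have : (ζ - 1) * ∫ g, ((g : Matrix (Fin n) (Fin n) ℂ)).trace ∂μ = 0 := by
    rw [sub_mul, one_mul, hinv, sub_self]
  exact (mul_eq_zero.mp this).resolve_left (sub_ne_zero.mpr hζ1)

/-- `∫_{SU(n)} Re tr g dg = 0` for `n ≥ 2`. [folklore] -/
theorem integral_re_trace_haar_eq_zero (hn : 2 ≤ n) :
    ∫ g, ((g : Matrix (Fin n) (Fin n) ℂ)).trace.re
      ∂(haarProbability (Matrix.specialUnitaryGroup (Fin n) ℂ)) = 0 := by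
  haveI : SecondCountableTopology (Matrix (Fin n) (Fin n) ℂ) :=
    inferInstanceAs (SecondCountableTopology (Fin n → Fin n → ℂ))
  haveI : SecondCountableTopology (Matrix.specialUnitaryGroup (Fin n) ℂ) :=
    Topology.IsEmbedding.subtypeVal.secondCountableTopology
  have hc : Continuous fun g : Matrix.specialUnitaryGroup (Fin n) ℂ =>
      ((g : Matrix (Fin n) (Fin n) ℂ)).trace :=
    continuous_subtype_val.matrix_trace
  have hint : Integrable (fun g : Matrix.specialUnitaryGroup (Fin n) ℂ =>
      ((g : Matrix (Fin n) (Fin n) ℂ)).trace) (haarProbability (Matrix.specialUnitaryGroup (Fin n) ℂ)) :=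
    (BoundedContinuousFunction.mkOfCompact ⟨_, hc⟩).integrable _
  rw [← complex_re_integral_eq hint, integral_trace_haar_eq_zero hn, Complex.zero_re]

/-- **`E_{D[U]}[Re tr U_p] = 0`** for every plaquette, `n ≥ 2`, `L ≥ 2`. [folklore] -/
theorem integral_re_trace_plaquetteHolonomy_eq_zero (hL : 2 ≤ L) (hn : 2 ≤ n) (x : Site d L)
    {i j : Fin d} (hij : i ≠ j) :
    ∫ U, (((plaquetteHolonomy U x i j : Matrix.specialUnitaryGroup (Fin n) ℂ) :
        Matrix (Fin n) (Fin n) ℂ)).trace.re ∂(trivialMeasure (Matrix.specialUnitaryGroup (Fin n) ℂ) d L)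
      = 0 := by
  have hc : Continuous fun g : Matrix.specialUnitaryGroup (Fin n) ℂ =>
      ((g : Matrix (Fin n) (Fin n) ℂ)).trace.re :=
    Complex.continuous_re.comp (continuous_subtype_val.matrix_trace)
  rw [integral_comp_plaquetteHolonomy_eq_haar hL x hij hc, integral_re_trace_haar_eq_zero hn]

/-- **`E_{D[U]}[S_W] = n · #plaquettes`** (`n ≥ 2`, `L ≥ 2`): the mean Wilson action in the trivial
theory — Lüscher's `Ċ^{(0)} = -⟨S_W⟩₀`, every volume. [ours] -/
theorem integral_wilsonAction_trivial (hL : 2 ≤ L) (hn : 2 ≤ n) :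
    ∫ U, wilsonAction (StrongCoupling.defRep n) U
        ∂(trivialMeasure (Matrix.specialUnitaryGroup (Fin n) ℂ) d L)
      = n * Fintype.card (Plaquette d L) := by
  haveI : IsProbabilityMeasure (trivialMeasure (Matrix.specialUnitaryGroup (Fin n) ℂ) d L) := by
    unfold trivialMeasure; infer_instance
  have hholc : ∀ p : Plaquette d L, Continuous fun U : GaugeConfig d L
      (Matrix.specialUnitaryGroup (Fin n) ℂ) => plaquetteHolonomy U p.1 p.2.1.1 p.2.1.2 := fun p => by
    unfold plaquetteHolonomy
    fun_prop
  have hre : ∀ p : Plaquette d L, Integrable (fun U : GaugeConfig d L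
      (Matrix.specialUnitaryGroup (Fin n) ℂ) =>
        ((StrongCoupling.defRep n) (plaquetteHolonomy U p.1 p.2.1.1 p.2.1.2)).trace.re)
      (trivialMeasure (Matrix.specialUnitaryGroup (Fin n) ℂ) d L) := fun p =>
    integrable_trivialMeasure_of_continuous
      (Complex.continuous_re.comp ((continuous_subtype_val.comp (hholc p)).matrix_trace))
  have hterm : ∀ p : Plaquette d L, Integrable (fun U : GaugeConfig d L
      (Matrix.specialUnitaryGroup (Fin n) ℂ) => (n : ℝ) -
        ((StrongCoupling.defRep n) (plaquetteHolonomy U p.1 p.2.1.1 p.2.1.2)).trace.re)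
      (trivialMeasure (Matrix.specialUnitaryGroup (Fin n) ℂ) d L) := fun p =>
    (integrable_const _).sub (hre p)
  have hp : ∀ p : Plaquette d L, ∫ U, ((n : ℝ) -
      ((StrongCoupling.defRep n) (plaquetteHolonomy U p.1 p.2.1.1 p.2.1.2)).trace.re)
      ∂(trivialMeasure (Matrix.specialUnitaryGroup (Fin n) ℂ) d L) = n := fun p => by
    rw [integral_sub (integrable_const _) (hre p), integral_const, smul_eq_mul, probReal_univ,
      one_mul]
    have h0 := integral_re_trace_plaquetteHolonomy_eq_zero (d := d) (n := n) hL hn p.1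
      (ne_of_lt p.2.2)
    simp only [StrongCoupling.defRep, Submonoid.subtype_apply]
    rw [h0, sub_zero]
  unfold wilsonAction
  rw [integral_finsetSum _ fun p _ => hterm p]
  simp only [hp, Finset.sum_const, Finset.card_univ, nsmul_eq_mul]
  ring

/-- **`m₂(n) = ∫_{SU(n)} (Re tr g)² dg > 0`.** [folklore] -/
theorem haarSqReTrace_pos (hn : 1 ≤ n) :
    0 < ∫ g, ((g : Matrix (Fin n) (Fin n) ℂ)).trace.re ^ 2
      ∂(haarProbability (Matrix.specialUnitaryGroup (Fin n) ℂ)) := by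
  haveI : SecondCountableTopology (Matrix (Fin n) (Fin n) ℂ) :=
    inferInstanceAs (SecondCountableTopology (Fin n → Fin n → ℂ))
  haveI : SecondCountableTopology (Matrix.specialUnitaryGroup (Fin n) ℂ) :=
    Topology.IsEmbedding.subtypeVal.secondCountableTopology
  set f : Matrix.specialUnitaryGroup (Fin n) ℂ → ℝ := fun g =>
    ((g : Matrix (Fin n) (Fin n) ℂ)).trace.re ^ 2 with hfdef
  have hc : Continuous f :=
    (Complex.continuous_re.comp (continuous_subtype_val.matrix_trace)).pow 2
  have hint : Integrable f (haarProbability (Matrix.specialUnitaryGroup (Fin n) ℂ)) :=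
    (BoundedContinuousFunction.mkOfCompact ⟨_, hc⟩).integrable _
  rw [integral_pos_iff_support_of_nonneg (fun g => sq_nonneg _) hint]
  have hopen : IsOpen (Function.support f) := hc.isOpen_support
  have h1 : (1 : Matrix.specialUnitaryGroup (Fin n) ℂ) ∈ Function.support f := by
    rw [Function.mem_support, hfdef]
    simp only [OneMemClass.coe_one, Matrix.trace_one, Fintype.card_fin, Complex.natCast_re, ne_eq,
      pow_eq_zero_iff two_ne_zero, Nat.cast_eq_zero]
    omega
  exact hopen.measure_pos _ ⟨1, h1⟩

/-- **`E_{D[U]}[(Re tr U_p)²] = m₂(n)`**, independent of the volume (`L ≥ 2`) and the plaquette.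
[ours] -/
theorem integral_sq_re_trace_plaquetteHolonomy (hL : 2 ≤ L) (x : Site d L) {i j : Fin d}
    (hij : i ≠ j) :
    ∫ U, (((plaquetteHolonomy U x i j : Matrix.specialUnitaryGroup (Fin n) ℂ) :
        Matrix (Fin n) (Fin n) ℂ)).trace.re ^ 2
        ∂(trivialMeasure (Matrix.specialUnitaryGroup (Fin n) ℂ) d L)
      = ∫ g, ((g : Matrix (Fin n) (Fin n) ℂ)).trace.re ^ 2
        ∂(haarProbability (Matrix.specialUnitaryGroup (Fin n) ℂ)) :=
  integral_comp_plaquetteHolonomy_eq_haar hL x hij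
    ((Complex.continuous_re.comp (continuous_subtype_val.matrix_trace)).pow 2)

end Haar

end Summit.Ventures.LatticeQCDFlow.TrivializingMaps
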